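import Summits.KontsevichZagierPeriods.KontsevichZagierPeriods.Theorems.RootDecompQuadraticDescentPair18HomotopyP16

/-! # `RootDecompQuadraticDescentPair18HomotopyP17` — part 17/31 of the mechanical ≤400-line split of `Pair18Homotopy_v14_noguard.lean` (sha256 72e9c8442b4af820…)
Source: decomp-kz lens-6 g9 `Pair18Homotopy.lean` v14 (HOME/decomp-kz-lens-6/g9/, sha256 3dda3232…; critic g4-48/g4-53/g4-56/g5 CLEARED; census pair #18 of crux stmt-KontsevichZagierPeriods-28994: homotopy cells, duplications, inversions, Euler–Landen, arc/angle regions; terminal `pair18_g8strips_of_grid : hEuler → hGrid → hAng4 → (g8 form of #18)`); `#guard_msgs … #print axioms` pins removed for landing.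
Split by census-1 g9 `gen/splitlean.py`: scopes re-opened with their `open`/`variable`/`set_option` context; mathematics and declaration order unchanged. -/

set_option linter.unusedSimpArgs false
noncomputable section
open _root_.Set MvPolynomial
namespace Summit.KontsevichZagierPeriods.RootDecompQuadraticDescent.Pair18Homotopy
open Literature.NumberTheory.Transcendental
open Literature.NumberTheory.Transcendental.KZ (RFun cube)
open Summit.KontsevichZagierPeriods.RootDecompQuadraticDescent.DarkPairs (rel_reflect_rep rel_double)
/-- Auxiliary step `vec2_1` (§2b): vec2 1. [bookkeeping] -/
private theorem vec2_1 (a b : ℝ) : (![a, b] : Fin 2 → ℝ) 1 = b := rfl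

/-- Auxiliary step `vec2_0` (§2b): vec2 0. [bookkeeping] -/
private theorem vec2_0 (a b : ℝ) : (![a, b] : Fin 2 → ℝ) 0 = a := rfl

/-- Auxiliary step `cube2` (§0): cube2. [bookkeeping] -/
private theorem cube2 {x : Fin 2 → ℝ} (hx : x ∈ KZ.cube 2) : (0 ≤ x 0 ∧ x 0 ≤ 1) ∧ (0 ≤ x 1 ∧ x 1 ≤ 1) := ⟨hx 0, hx 1⟩

section Arc2
open Literature.ModelTheory.ExponentialFields (IsSemialgebraic isSemialgebraic_setOf_eval_le
  isSemialgebraic_setOf_eval_pos)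

/-- Auxiliary step `P9b_image`: P9b image. [bookkeeping] -/
theorem P9b_image : P9b = (fun z : Fin 2 → ℝ => (![z 0, ((8 / 9 : ℚ) : ℝ) * z 1 + ((1 / 9 : ℚ) : ℝ)] : Fin 2 → ℝ)) '' cube 2 := by
  ext w
  constructor
  · rintro ⟨hw, hge⟩
    simp only [mem_setOf_eq] at hge
    have hw1' := (hw 1).2
    refine ⟨![w 0, (9 * w 1 - 1) / 8], ?_, ?_⟩
    · intro i
      fin_cases i
      · simpa using hw 0
      · exact ⟨by simp; linarith, by simp; linarith⟩
    · funext i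
      fin_cases i
      · simp
      · simp; ring
  · rintro ⟨z, hz, rfl⟩
    have hz1 := (hz 1).1
    have hz1' := (hz 1).2
    refine ⟨fun i => ?_, ?_⟩
    · fin_cases i
      · simpa using hz 0
      · exact ⟨by simp; positivity, by simp; linarith⟩
    · simp only [mem_setOf_eq, vec2_1, Matrix.cons_val_one, Matrix.head_cons]
      push_cast
      linarith

/-- **two-piece split of coordinate 1** at `t = 1/9`. -/
theorem rel_split9 (T S₀ S₁ : RFun 2)
    (h₀ : ∀ z ∈ cube 2, S₀.fn z = T.fn ![z 0, ((1 / 9 : ℚ) : ℝ) * z 1 + ((0 : ℚ) : ℝ)] * ((1 / 9 : ℚ) : ℝ))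
    (h₁ : ∀ z ∈ cube 2, S₁.fn z = T.fn ![z 0, ((8 / 9 : ℚ) : ℝ) * z 1 + ((1 / 9 : ℚ) : ℝ)] * ((8 / 9 : ℚ) : ℝ)) :
    KZ.of T.rep - KZ.of S₀.rep - KZ.of S₁.rep ∈ KZ.relations := by
  have sa : P9a ⊆ T.rep.domain := fun _ hz => hz.1
  have sb : P9b ⊆ T.rep.domain := fun _ hz => hz.1
  have ca := cov_affine1 T S₀ (1 / 9) 0 (by positivity) P9a isSemialgebraic_P9a sa P9a_image h₀
  have cb := cov_affine1 T S₁ (8 / 9) (1 / 9) (by positivity) P9b isSemialgebraic_P9b sb P9b_image h₁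
  have add1 : KZ.of T.rep - KZ.of (T.rep.restrict P9a isSemialgebraic_P9a sa)
      - KZ.of (T.rep.restrict P9b isSemialgebraic_P9b sb) ∈ KZ.relations := by
    refine KZ.domainAddRel_subset_relations ⟨2, T.rep, T.rep.restrict P9a isSemialgebraic_P9a sa,
      T.rep.restrict P9b isSemialgebraic_P9b sb, ?_, ?_, fun _ _ => rfl, fun _ _ => rfl, rfl⟩
    · simp only [KZ.IntegralRep.domain_restrict, RFun.rep_domain, P9a, P9b]
      ext z
      simp only [mem_union, mem_inter_iff, mem_setOf_eq]
      constructor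
      · intro hz
        rcases le_total (9 * z 1) 1 with h | h
        · exact Or.inl ⟨hz, h⟩
        · exact Or.inr ⟨hz, h⟩
      · rintro (⟨hz, _⟩ | ⟨hz, _⟩) <;> exact hz
    · refine MeasureTheory.measure_mono_null ?_ volume_cut9
      simp only [KZ.IntegralRep.domain_restrict, P9a, P9b]
      rintro z ⟨⟨_, h1⟩, ⟨_, h2⟩⟩
      simp only [mem_setOf_eq] at h1 h2 ⊢
      exact le_antisymm h1 h2
  have e : KZ.of T.rep - KZ.of S₀.rep - KZ.of S₁.rep =
      (KZ.of T.rep - KZ.of (T.rep.restrict P9a isSemialgebraic_P9a sa) - KZ.of (T.rep.restrict P9b isSemialgebraic_P9b sb))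
      - (KZ.of S₀.rep - KZ.of (T.rep.restrict P9a isSemialgebraic_P9a sa))
      - (KZ.of S₁.rep - KZ.of (T.rep.restrict P9b isSemialgebraic_P9b sb)) := by abel
  rw [e]
  exact sub_mem (sub_mem add1 ca) cb

/-- `[B63] ≡ [Th7] + [A7]` (`arctan²√63` splits at `v = √7`). -/
theorem B63_split : KZ.of B63.rep - KZ.of Th7.rep - KZ.of A7.rep ∈ KZ.relations := by
  refine rel_split9 B63 Th7 A7 ?_ ?_
  · intro z hz
    obtain ⟨h0, h1⟩ := cube2 hz
    have ha : (0 : ℝ) < 1 + 7 * z 1 := by linarith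
    have hb : (0 : ℝ) < 1 + 7 * z 1 * z 0 * z 0 := by nlinarith [mul_nonneg h1.1 (mul_nonneg h0.1 h0.1)]
    simp only [B63, Th7, B63Den, Th7Den, RFun.fn, map_add, map_sub, map_mul, map_pow, map_neg, aeval_C, aeval_X, map_one, map_ofNat, eq_ratCast, Rat.cast_one, Rat.cast_ofNat, Rat.cast_div, Rat.cast_neg, vec2_0, vec2_1, Matrix.cons_val_zero, Matrix.cons_val_one, Matrix.head_cons]
    push_cast
    have e1 : (1:ℝ) + 63 * (1 / 9 * z 1 + 0) = 1 + 7 * z 1 := by ring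
    have e2 : (1:ℝ) + 63 * (1 / 9 * z 1 + 0) * z 0 * z 0 = 1 + 7 * z 1 * z 0 * z 0 := by ring
    rw [e1, e2]
    field_simp
    ring
  · intro z hz
    obtain ⟨h0, h1⟩ := cube2 hz
    have ha : (0 : ℝ) < 1 + 7 * z 1 := by linarith
    have hb : (0 : ℝ) < 1 + 7 * (1 + 8 * z 1) * z 0 * z 0 := by
      nlinarith [mul_nonneg (mul_nonneg h1.1 h0.1) h0.1, mul_nonneg h0.1 h0.1]
    simp only [B63, A7, B63Den, A7Den, RFun.fn, map_add, map_sub, map_mul, map_pow, map_neg, aeval_C, aeval_X, map_one, map_ofNat, eq_ratCast, Rat.cast_one, Rat.cast_ofNat, Rat.cast_div, Rat.cast_neg, vec2_0, vec2_1, Matrix.cons_val_zero, Matrix.cons_val_one, Matrix.head_cons]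
    have e1 : (1:ℝ) + 63 * (8 / 9 * z 1 + 1 / 9) = 8 * (1 + 7 * z 1) := by ring
    have e2 : (1:ℝ) + 63 * (8 / 9 * z 1 + 1 / 9) * z 0 * z 0 = 1 + 7 * (1 + 8 * z 1) * z 0 * z 0 := by ring
    rw [e1, e2]
    field_simp
    ring

/-- **the second critical strip decided** modulo the standard boxes `B63 = (2π−4θ)²`, `Th7 = θ²` and the
log²2 currencies: `[Crit2] − [B63] + [Th7] − [N7] − [N7|w≤t] + 3•[Lbox] ∈ KZ.relations` (exact). -/
theorem crit2_exact : KZ.of Crit2.rep - KZ.of B63.rep + KZ.of Th7.rep - KZ.of N7.rep - KZ.of N7U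
    + 3 • KZ.of Lbox.rep ∈ KZ.relations := by
  have e : KZ.of Crit2.rep - KZ.of B63.rep + KZ.of Th7.rep - KZ.of N7.rep - KZ.of N7U + 3 • KZ.of Lbox.rep =
      (KZ.of S2.rep - KZ.of A7.rep - KZ.of CL3.rep) - (KZ.of S2.rep - KZ.of Crit2b.rep - KZ.of CL2.rep)
      - (KZ.of Crit2b.rep - KZ.of Crit2.rep) - (KZ.of B63.rep - KZ.of Th7.rep - KZ.of A7.rep)
      + (KZ.of CL3.rep - KZ.of N7.rep - KZ.of N7U) - (KZ.of CL2.rep - 3 • KZ.of Lbox.rep) := by abel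
  rw [e]
  exact sub_mem (add_mem (sub_mem (sub_mem (sub_mem S2_a S2_b) Crit2b_rel) B63_split) CL3_rel) CL2_rel

end Arc2

/-! ## §11 `hElem7`: both critical strips replaced by standard boxes

With `crit2_exact` the residual hypothesis has THREE pencil brackets `[Gm], [Gp], 2[Sp]+2[Sm]+[M2]` left, against the
standard arctan boxes `Th7 = θ²`, `B63 = (2π−4θ)²`, `Ax0 = π²/24` and log²2 currencies. -/
section Residual3

/-- **#18 reduced to three arctan-type evaluations** (exact). -/
theorem pair18_g8strips_of_elem7
    (hElem7 : 4 • KZ.of Gm.rep + 2 • KZ.of Gp.rep + 2 • (2 • KZ.of Sp.rep + 2 • KZ.of Sm.rep + KZ.of M2.rep)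
      + 11 • KZ.of Th7.rep - KZ.of B63.rep - 42 • KZ.of Ax0.rep - KZ.of N7U + 3 • KZ.of Lbox.rep - 3 • KZ.of Lq.rep
      - KZ.of MT ∈ KZ.relations) :
    KZ.of U1.rep - KZ.of U2r.rep + KZ.of SL.rep - 2 • KZ.of K12c.rep + 2 • KZ.of Kh.rep ∈ KZ.relations := by
  refine pair18_g8strips_of_elem6 ?_
  have e : 4 • KZ.of Gm.rep + 2 • KZ.of Gp.rep + 2 • (2 • KZ.of Sp.rep + 2 • KZ.of Sm.rep + KZ.of M2.rep)
      + 10 • KZ.of Th7.rep + KZ.of N7.rep - 3 • KZ.of Lq.rep - KZ.of Crit2.rep - 42 • KZ.of Ax0.rep - KZ.of MT =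
      (4 • KZ.of Gm.rep + 2 • KZ.of Gp.rep + 2 • (2 • KZ.of Sp.rep + 2 • KZ.of Sm.rep + KZ.of M2.rep)
      + 11 • KZ.of Th7.rep - KZ.of B63.rep - 42 • KZ.of Ax0.rep - KZ.of N7U + 3 • KZ.of Lbox.rep - 3 • KZ.of Lq.rep
      - KZ.of MT)
      - (KZ.of Crit2.rep - KZ.of B63.rep + KZ.of Th7.rep - KZ.of N7.rep - KZ.of N7U + 3 • KZ.of Lbox.rep) := by abel
  rw [e]
  exact sub_mem hElem7 crit2_exact

/-- the same with the (C′) strip conclusion of §3. -/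
theorem pair18_strips_of_elem7
    (hElem7 : 4 • KZ.of Gm.rep + 2 • KZ.of Gp.rep + 2 • (2 • KZ.of Sp.rep + 2 • KZ.of Sm.rep + KZ.of M2.rep)
      + 11 • KZ.of Th7.rep - KZ.of B63.rep - 42 • KZ.of Ax0.rep - KZ.of N7U + 3 • KZ.of Lbox.rep - 3 • KZ.of Lq.rep
      - KZ.of MT ∈ KZ.relations) :
    KZ.of U1.rep - KZ.of U2r.rep + KZ.of SL.rep - 2 • (KZ.of Sp.rep + KZ.of Sm.rep) + 2 • (KZ.of Shp.rep + KZ.of Shm.rep)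
      ∈ KZ.relations := by
  refine pair18_strips_of_elem6 ?_
  have e : 4 • KZ.of Gm.rep + 2 • KZ.of Gp.rep + 2 • (2 • KZ.of Sp.rep + 2 • KZ.of Sm.rep + KZ.of M2.rep)
      + 10 • KZ.of Th7.rep + KZ.of N7.rep - 3 • KZ.of Lq.rep - KZ.of Crit2.rep - 42 • KZ.of Ax0.rep - KZ.of MT =
      (4 • KZ.of Gm.rep + 2 • KZ.of Gp.rep + 2 • (2 • KZ.of Sp.rep + 2 • KZ.of Sm.rep + KZ.of M2.rep)
      + 11 • KZ.of Th7.rep - KZ.of B63.rep - 42 • KZ.of Ax0.rep - KZ.of N7U + 3 • KZ.of Lbox.rep - 3 • KZ.of Lq.rep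
      - KZ.of MT)
      - (KZ.of Crit2.rep - KZ.of B63.rep + KZ.of Th7.rep - KZ.of N7.rep - KZ.of N7U + 3 • KZ.of Lbox.rep) := by abel
  rw [e]
  exact sub_mem hElem7 crit2_exact

end Residual3

/-! ## §12 ANGLE DOUBLING is a rational self-map of the arctan box family

`Bbox U = [□², U/((1+Ut)(1+Utb²))] = arctan²√U`.  After `t = s²` (`Bq U = [2Us/((1+Us²)(1+Us²b²))]`, coordinates
`(s,b)`), the map `Φ_U(s,b) = ((1−U)s/(1−Us²), b(1−Us²)/(1−Us²b²))` is a rational bijection of the box with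
`Φ_U^*(ω_{U'}) = 4·ω_U`, `U'(1−U)² = 4U` — it realises `arctan√U' = 2·arctan√U` on BOTH the outer variable
(`v' = 2v/(1−v²)`, `v = s√U`) and the inner arctan-integral (`w' = 2w/(1−w²)`, `w = vb`).  Hence
`[Bbox U'] ≡ 4•[Bbox U]` for `0 < U < 1`; with `U = 1/7 ↦ 7/9 ↦ 63`: `[B63] ≡ 16•[B(1/7)]`, `B(1/7) = (π/2 − θ)²`. -/
section Dbl

open Literature.ModelTheory.ExponentialFields (IsSemialgebraic isSemialgebraic_setOf_eval_le
  isSemialgebraic_setOf_eval_pos)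

/-- Auxiliary step `dbl_pos1` (§12): dbl pos1. [bookkeeping] -/
theorem dbl_pos1 (U s : ℝ) (hU0 : 0 ≤ U) (hU1 : U < 1) (hs0 : 0 ≤ s) (hs1 : s ≤ 1) : 0 < 1 - U * s * s := by
  have t1 : s * s ≤ 1 := mul_le_one₀ hs1 hs0 hs1
  have t2 : U * (s * s) ≤ U * 1 := mul_le_mul_of_nonneg_left t1 hU0
  nlinarith
/-- Auxiliary step `dbl_pos2` (§12): dbl pos2. [bookkeeping] -/
theorem dbl_pos2 (U s b : ℝ) (hU0 : 0 ≤ U) (hU1 : U < 1) (hs0 : 0 ≤ s) (hs1 : s ≤ 1) (hb0 : 0 ≤ b)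
    (hb1 : b ≤ 1) : 0 < 1 - U * s * s * b * b := by
  have t1 : s * s ≤ 1 := mul_le_one₀ hs1 hs0 hs1
  have t2 : s * s * b ≤ 1 := mul_le_one₀ t1 hb0 hb1
  have t3 : s * s * b * b ≤ 1 := mul_le_one₀ t2 hb0 hb1
  have t4 : U * (s * s * b * b) ≤ U * 1 := mul_le_mul_of_nonneg_left t3 hU0
  nlinarith

/-- Auxiliary definition `BqDen` (§12): Bq Den. [bookkeeping] -/
def BqDen (U : ℚ) : MvPolynomial (Fin 2) ℚ := (C 1 + C U * X 0 * X 0) * (C 1 + C U * X 0 * X 0 * X 1 * X 1)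
/-- Auxiliary step `BqDen_pos` (§12): Bq Den pos. [bookkeeping] -/
theorem BqDen_pos (U : ℚ) (hU : 0 ≤ U) {x : Fin 2 → ℝ} (hx : x ∈ KZ.cube 2) : 0 < aeval x (BqDen U) := by
  obtain ⟨h0, h1⟩ := cube2 hx
  have hU' : (0:ℝ) ≤ U := by exact_mod_cast hU
  simp only [map_add, map_sub, map_mul, map_pow, map_neg, aeval_C, aeval_X, map_one, map_ofNat, eq_ratCast, Rat.cast_one, Rat.cast_ofNat, Rat.cast_div, Rat.cast_neg, vec2_0, vec2_1, Matrix.cons_val_zero, Matrix.cons_val_one, Matrix.head_cons, BqDen]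
  have : (0:ℝ) < 1 + U * x 0 * x 0 := by nlinarith [mul_nonneg hU' (mul_nonneg h0.1 h0.1)]
  have : (0:ℝ) < 1 + U * x 0 * x 0 * x 1 * x 1 := by
    nlinarith [mul_nonneg (mul_nonneg hU' (mul_nonneg h0.1 h0.1)) (mul_nonneg h1.1 h1.1)]
  positivity
/-- `Bq U = [2Us/((1+Us²)(1+Us²b²))]` (coordinates `s = z0`, `b = z1`). -/
def Bq (U : ℚ) (hU : 0 ≤ U) : RFun 2 := ⟨C (2 * U) * X 0, BqDen U, fun _ hx => (BqDen_pos U hU hx).ne'⟩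
/-- Auxiliary definition `Bq4` (§12): Bq4. [bookkeeping] -/
def Bq4 (U : ℚ) (hU : 0 ≤ U) : RFun 2 := ⟨C (8 * U) * X 0, BqDen U, fun _ hx => (BqDen_pos U hU hx).ne'⟩
/-- Auxiliary definition `BboxDen` (§12): Bbox Den. [bookkeeping] -/
def BboxDen (U : ℚ) : MvPolynomial (Fin 2) ℚ := (C 1 + C U * X 1) * (C 1 + C U * X 1 * X 0 * X 0)
/-- Auxiliary step `BboxDen_pos` (§12): Bbox Den pos. [bookkeeping] -/
theorem BboxDen_pos (U : ℚ) (hU : 0 ≤ U) {x : Fin 2 → ℝ} (hx : x ∈ KZ.cube 2) : 0 < aeval x (BboxDen U) := by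
  obtain ⟨h0, h1⟩ := cube2 hx
  have hU' : (0:ℝ) ≤ U := by exact_mod_cast hU
  simp only [map_add, map_sub, map_mul, map_pow, map_neg, aeval_C, aeval_X, map_one, map_ofNat, eq_ratCast, Rat.cast_one, Rat.cast_ofNat, Rat.cast_div, Rat.cast_neg, vec2_0, vec2_1, Matrix.cons_val_zero, Matrix.cons_val_one, Matrix.head_cons, BboxDen]
  have : (0:ℝ) < 1 + U * x 1 := by nlinarith [mul_nonneg hU' h1.1]
  have : (0:ℝ) < 1 + U * x 1 * x 0 * x 0 := by nlinarith [mul_nonneg (mul_nonneg hU' h1.1) (mul_nonneg h0.1 h0.1)]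
  positivity
/-- **the arctan box family** `Bbox U = [□², U/((1+Ut)(1+Utb²))] = arctan²√U` (`b = z0`, `t = z1`). -/
def Bbox (U : ℚ) (hU : 0 ≤ U) : RFun 2 := ⟨C U, BboxDen U, fun _ hx => (BboxDen_pos U hU hx).ne'⟩
/-- Auxiliary definition `BswDen` (§12): Bsw Den. [bookkeeping] -/
def BswDen (U : ℚ) : MvPolynomial (Fin 2) ℚ := (C 1 + C U * X 0) * (C 1 + C U * X 0 * X 1 * X 1)
/-- Auxiliary step `BswDen_pos` (§12): Bsw Den pos. [bookkeeping] -/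
theorem BswDen_pos (U : ℚ) (hU : 0 ≤ U) {x : Fin 2 → ℝ} (hx : x ∈ KZ.cube 2) : 0 < aeval x (BswDen U) := by
  obtain ⟨h0, h1⟩ := cube2 hx
  have hU' : (0:ℝ) ≤ U := by exact_mod_cast hU
  simp only [map_add, map_sub, map_mul, map_pow, map_neg, aeval_C, aeval_X, map_one, map_ofNat, eq_ratCast, Rat.cast_one, Rat.cast_ofNat, Rat.cast_div, Rat.cast_neg, vec2_0, vec2_1, Matrix.cons_val_zero, Matrix.cons_val_one, Matrix.head_cons, BswDen]
  have : (0:ℝ) < 1 + U * x 0 := by nlinarith [mul_nonneg hU' h0.1]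
  have : (0:ℝ) < 1 + U * x 0 * x 1 * x 1 := by nlinarith [mul_nonneg (mul_nonneg hU' h0.1) (mul_nonneg h1.1 h1.1)]
  positivity
/-- Auxiliary definition `Bsw` (§12): Bsw. [bookkeeping] -/
def Bsw (U : ℚ) (hU : 0 ≤ U) : RFun 2 := ⟨C U, BswDen U, fun _ hx => (BswDen_pos U hU hx).ne'⟩

/-- Auxiliary step `Bq4_nsmul` (§12): Bq4 nsmul. [bookkeeping] -/
theorem Bq4_nsmul (U : ℚ) (hU : 0 ≤ U) : KZ.of (Bq4 U hU).rep - 4 • KZ.of (Bq U hU).rep ∈ KZ.relations := by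
  refine rel_nsmul 4 (Bq4 U hU) (Bq U hU) fun z hz => ?_
  simp only [Bq4, Bq, BqDen, RFun.fn, Nat.cast_ofNat, map_add, map_sub, map_mul, map_pow, map_neg, aeval_C, aeval_X, map_one, map_ofNat, eq_ratCast, Rat.cast_one, Rat.cast_ofNat, Rat.cast_div, Rat.cast_neg, vec2_0, vec2_1, Matrix.cons_val_zero, Matrix.cons_val_one, Matrix.head_cons]
  ring

/-- Auxiliary step `Bq_Bsw` (§12): Bq Bsw. [bookkeeping] -/
theorem Bq_Bsw (U : ℚ) (hU : 0 ≤ U) : KZ.of (Bq U hU).rep - KZ.of (Bsw U hU).rep ∈ KZ.relations := by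
  refine rel_sq (Bq U hU) (Bsw U hU) fun z hz => ?_
  simp only [Bq, Bsw, BqDen, BswDen, RFun.fn, map_add, map_sub, map_mul, map_pow, map_neg, aeval_C, aeval_X, map_one, map_ofNat, eq_ratCast, Rat.cast_one, Rat.cast_ofNat, Rat.cast_div, Rat.cast_neg, vec2_0, vec2_1, Matrix.cons_val_zero, Matrix.cons_val_one, Matrix.head_cons]
  ring

/-- Auxiliary step `Bsw_Bbox` (§12): Bsw Bbox. [bookkeeping] -/
theorem Bsw_Bbox (U : ℚ) (hU : 0 ≤ U) : KZ.of (Bsw U hU).rep - KZ.of (Bbox U hU).rep ∈ KZ.relations := by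
  refine rel_swap (Bsw U hU) (Bbox U hU) fun z hz => ?_
  simp only [Bsw, Bbox, BswDen, BboxDen, RFun.fn, map_add, map_sub, map_mul, map_pow, map_neg, aeval_C, aeval_X, map_one, map_ofNat, eq_ratCast, Rat.cast_one, Rat.cast_ofNat, Rat.cast_div, Rat.cast_neg, vec2_0, vec2_1, Matrix.cons_val_zero, Matrix.cons_val_one, Matrix.head_cons]

/-- `[Bq U] ≡ [Bbox U]` -/
theorem Bq_Bbox (U : ℚ) (hU : 0 ≤ U) : KZ.of (Bq U hU).rep - KZ.of (Bbox U hU).rep ∈ KZ.relations := by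
  have := KZ.relations.add_mem (Bq_Bsw U hU) (Bsw_Bbox U hU)
  convert this using 1
  abel

/-- the components of the doubling map as cube-rational data (for semialgebraicity) -/
def DblS (U : ℚ) (hU0 : 0 ≤ U) (hU1 : U < 1) : RFun 2 := ⟨C (1 - U) * X 0, C 1 - C U * X 0 * X 0, fun x hx => by
  obtain ⟨h0, h1⟩ := cube2 hx
  have hU' : (U:ℝ) < 1 := by exact_mod_cast hU1
  have hU'' : (0:ℝ) ≤ U := by exact_mod_cast hU0
  simp only [map_add, map_sub, map_mul, map_pow, map_neg, aeval_C, aeval_X, map_one, map_ofNat, eq_ratCast, Rat.cast_one, Rat.cast_ofNat, Rat.cast_div, Rat.cast_neg, vec2_0, vec2_1, Matrix.cons_val_zero, Matrix.cons_val_one, Matrix.head_cons]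
  exact (dbl_pos1 U (x 0) hU'' hU' h0.1 h0.2).ne'⟩
/-- Auxiliary definition `DblB` (§12): Dbl B. [bookkeeping] -/
def DblB (U : ℚ) (hU0 : 0 ≤ U) (hU1 : U < 1) : RFun 2 :=
  ⟨X 1 * (C 1 - C U * X 0 * X 0), C 1 - C U * X 0 * X 0 * X 1 * X 1, fun x hx => by
  obtain ⟨h0, h1⟩ := cube2 hx
  have hU' : (U:ℝ) < 1 := by exact_mod_cast hU1
  have hU'' : (0:ℝ) ≤ U := by exact_mod_cast hU0
  simp only [map_add, map_sub, map_mul, map_pow, map_neg, aeval_C, aeval_X, map_one, map_ofNat, eq_ratCast, Rat.cast_one, Rat.cast_ofNat, Rat.cast_div, Rat.cast_neg, vec2_0, vec2_1, Matrix.cons_val_zero, Matrix.cons_val_one, Matrix.head_cons]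
  exact (dbl_pos2 U (x 0) (x 1) hU'' hU' h0.1 h0.2 h1.1 h1.2).ne'⟩

/-- the key rational identity `Φ_U^*(ω_{U'}) = 4 ω_U` (pointwise, with the Jacobian). -/
theorem dbl_key (U U' s b : ℝ) (hU' : U' * (1 - U) ^ 2 = 4 * U) (h1 : 1 - U ≠ 0) (h2 : 0 < 1 - U * s * s)
    (h3 : 0 < 1 - U * s * s * b * b) (h4 : 0 < 1 + U * s * s) (h5 : 0 < 1 + U * s * s * b * b) :
    8 * U * s / ((1 + U * s * s) * (1 + U * s * s * b * b)) =
      2 * U' * ((1 - U) * s / (1 - U * s * s)) /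
        ((1 + U' * ((1 - U) * s / (1 - U * s * s)) * ((1 - U) * s / (1 - U * s * s))) *
          (1 + U' * ((1 - U) * s / (1 - U * s * s)) * ((1 - U) * s / (1 - U * s * s)) *
            (b * (1 - U * s * s) / (1 - U * s * s * b * b)) * (b * (1 - U * s * s) / (1 - U * s * s * b * b)))) *
      ((1 - U) * (1 + U * s * s) / (1 - U * s * s) ^ 2 *
        ((1 - U * s * s) * (1 + U * s * s * b * b) / (1 - U * s * s * b * b) ^ 2)) := by
  have hU'' : U' = 4 * U / (1 - U) ^ 2 := by
    rw [eq_div_iff (pow_ne_zero 2 h1)]; exact hU'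
  subst hU''
  have h2' : (0:ℝ) < 1 - U * s ^ 2 := by nlinarith
  have h3' : (0:ℝ) < 1 - U * s ^ 2 * b ^ 2 := by nlinarith
  have h4' : (0:ℝ) < 1 + U * s ^ 2 := by nlinarith
  have h5' : (0:ℝ) < 1 + U * s ^ 2 * b ^ 2 := by nlinarith
  have e1 : 1 + 4 * U / (1 - U) ^ 2 * ((1 - U) * s / (1 - U * s * s)) * ((1 - U) * s / (1 - U * s * s)) =
      (1 + U * s * s) ^ 2 / (1 - U * s * s) ^ 2 := by
    field_simp; ring
  have e2 : 1 + 4 * U / (1 - U) ^ 2 * ((1 - U) * s / (1 - U * s * s)) * ((1 - U) * s / (1 - U * s * s)) *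
      (b * (1 - U * s * s) / (1 - U * s * s * b * b)) * (b * (1 - U * s * s) / (1 - U * s * s * b * b)) =
      (1 + U * s * s * b * b) ^ 2 / (1 - U * s * s * b * b) ^ 2 := by
    field_simp; ring
  rw [e1, e2]
  field_simp
  ring

end Dbl
end Summit.KontsevichZagierPeriods.RootDecompQuadraticDescent.Pair18Homotopy
end
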